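import Literature.Barriers.CriticalPhenomena.PlaquetteWalkHoleRootNearCells
import HarnessLib

/-!
# Barrier catalogue (SAWScalingLimit): LAW L AT DISTANCE ONE — four tight-frame witnesses around a domino hole

Leaf of `PlaquetteWalkHoleRootNearCells` (the every-position witness pattern of #878: reference root `w42 = (4, 2)`, hole
`(3, 2)`, far cell `(2, 2)`; `block42_mem_of_block_mem`, `exists_wound_witness_shift`). The landed witnesses avoiding the
cell below the hole (`nearBlockSU2`, `nearBlockSU1`) need column `6` — the column east of `rootE`; the lane's kit survey
(j295594, frame `[0,6]×[−1,4]`, tasks `((3,1),) US2 I6n` / `US1 I6n`) found under witnesses of both freenesses avoiding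
`holeS (3,1)` inside the columns `[1,5]` at the price of ONE extra row below (rows `−1 … 3`): typed here as `tightBlockSU2`,
`tightBlockSU1` (22 arcs each), with their row mirrors `tightBlockNO1`, `tightBlockNO2` (over witnesses avoiding `holeN (3,3)`
inside `[1,5]×[1,5]`; the reflection exchanges `w₁` and `w₂`). Each with `decide` certificates and its every-position theorem.
They serve the distance-one classification of LAW L (companion leaf `PlaquetteWalkHoleRootNearCellsClassification`): with
the root plaquette's eastern neighbour in the last column of a box, `holeS`/`holeN` stay harmless given three free rows on
their side, while `rootS`/`rootN` empty their route (`PlaquetteWalkHoleRootRootNotchEast`).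

Not in print; venture lane «pcv-sawmu», seat b-step0 gen 28 (kit j295594, HOME `code/step0/g27/nearcells/kit_j295594_RESULTS.txt`).

References: A. Glazman, I. Manolescu, arXiv:1708.00395v3, §1 (Fig. 1, Fig. 2, remark after eq. (1)), §2.1, §4.2, Lemma 2.1
[GlazmanManolescu2019]; A. Glazman, Electron. Commun. Probab. 20 (2015) no. 86, Lemma 3.1, proof pp. 6–7
[Glazman2015WeightedSAW]; R. Courant, H. Robbins, *What is Mathematics?* (1941/1958), Ch. V Appendix §2 (the even–odd
rule) [CourantRobbins1958].
-/

noncomputable section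

open Set Function Complex

namespace Literature.Barriers.CriticalPhenomena.PlaquetteWalk

open Literature.Probability.RandomPlanarGeometry.SAW.YangBaxter
open Real Complex

/-! ## The four witnesses (reference root `w42 = (4, 2)`, hole `(3, 2)`, far cell `(2, 2)`) -/

section Witnesses

/-- Tight-frame witness block `SU2`: the 22 cells of an under w₂-free wound witness (reference root `(4, 2)`,
hole `(3, 2)`, far cell `(2, 2)`) AVOIDING `holeS (3,1)` (it passes under it through `rootS` and row `−1`); cells in `[1,5]×[−1,3]` (kit j295594 of the lane).
[cite: GlazmanManolescu2019, §2.1 (finite domains of faces)] -/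
def tightBlockSU242 : List Face := [(1,-1),(1,0),(1,1),(1,2),(2,-1),(2,0),(2,1),(2,2),(2,3),(3,-1),(3,0),(3,3),(4,-1),(4,0),(4,1),(4,2),(4,3),(5,-1),(5,0),(5,1),(5,2),(5,3)]

/-- Its mid-edges (22 arcs). [cite: GlazmanManolescu2019, §1 (definition of the model), Fig. 1] -/
def tightSU2Mids : List MidEdge :=
  [.vert 4 2, .slant 4 2, .slant 4 1, .vert 4 0, .vert 3 0, .slant 2 1, .slant 2 2, .vert 2 2, .slant 1 2, .slant 1 1, .slant 1 0, .vert 2 (-1), .vert 3 (-1), .vert 4 (-1), .vert 5 (-1), .slant 5 0, .slant 5 1, .slant 5 2, .slant 5 3, .vert 5 3, .vert 4 3, .vert 3 3, .slant 2 3]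

/-- The witness as a walk of its block. [cite: GlazmanManolescu2019, §1 (definition of the model), Fig. 1] -/
def tightSU2Walk : YBWalk (dom tightBlockSU242) (w42.side .W) ((farW w42).side .N) where
  mids := tightSU2Mids
  head_eq := by decide
  getLast_eq := by decide
  nodup := by decide
  arc_mem := arc_mem_of_check (by decide)
  isChain := by decide
  noncross := noncross_of_check (by decide)

/-- The labelled witness. [cite: Glazman2015WeightedSAW, Lemma 3.1 (proof, pp. 6–7)] -/
def ωtightSU2 : ΩG (dom tightBlockSU242) (w42.side .W) (farW w42) := ⟨.N, tightSU2Walk⟩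

/-- Certificates: first hit `6`, `22` arcs, no later far-cell arc, first side `S`, w₂-free off the far cell, odd
eastern-ray count (`1`). [cite: Glazman2015WeightedSAW, Lemma 3.1 (proof, pp. 6–7)] [cite: CourantRobbins1958, Ch. V Appendix §2 (the even–odd rule)] -/
theorem ωtightSU2_cert : ωtightSU2.2.firstHitG = 6 ∧ ωtightSU2.2.arcs.length = 22 ∧
    (∀ j < 22, 6 < j → ωtightSU2.2.fc j ≠ farW w42) ∧ ωtightSU2.2.nth 6 = (farW w42).side .S ∧
    ωtightSU2.2.W2FreeOff (farW w42) ∧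
    Odd ((Finset.range 16).filter fun j => eastRayB w42 (ωtightSU2.2.nth (6 + j + 1)) = true).card := by
  refine ⟨by decide, by decide, by decide, by decide, by unfold YBWalk.W2FreeOff; decide, by decide⟩

/-- The block at the root plaquette `w`. [cite: GlazmanManolescu2019, §2.1, §4.2 (translation invariance)] -/
def tightBlockSU2 (w : Face) : List Face := tightBlockSU242.map (Face.shiftBy (refShift w))

/-- ★★★ The under w₂-free wound witness `SU2` at EVERY POSITION: any face list containing the translated block
carries a wound class-`B2a` under-walk at the far cell, w₂-free off it. [cite: GlazmanManolescu2019, §4.2 (translation invariance), Lemma 2.1]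
[cite: Glazman2015WeightedSAW, Lemma 3.1 (proof, pp. 6–7)] [cite: CourantRobbins1958, Ch. V Appendix §2 (the even–odd rule)] -/
theorem exists_under_W2FreeOff_of_tightBlockSU2 {Dl : List Face} {w : Face} (hB : ∀ c ∈ tightBlockSU2 w, c ∈ Dl)
    (hr : RootedFace (dom Dl) (w.side .W) (farW w)) (θ : ℝ) :
    ∃ (ω : ΩG (dom Dl) (w.side .W) (farW w)) (h : ω.IsB2a), ω.2.firstSideG = .S ∧
      ω.WE (fun _ => θ) ≠ excursionWinding θ ω.2.firstSideG (ω.z1 hr h) ω.1 ∧ ω.2.W2FreeOff (farW w) := by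
  have hB₀ := block42_mem_of_block_mem (B := tightBlockSU242) hB
  obtain ⟨hF, hn, hfc, hnth, hfree, hodd⟩ := ωtightSU2_cert
  let ω₀ : ΩG (dom (Dl.map (Face.shiftBy (-refShift w)))) (w42.side .W) (farW w42) :=
    ⟨.N, tightSU2Walk.mapDomain fun c hc => hB₀ c hc⟩
  have hF' : ω₀.2.firstHitG = 6 := hF
  have hn' : ω₀.2.arcs.length = 22 := hn
  have h₀ : ω₀.IsB2a := by
    refine ΩG.isB2a_of_forall_fc_ne (by rw [hF', hn']; omega) fun j hj1 hj2 => ?_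
    rw [hF'] at hj1
    rw [hn'] at hj2
    exact hfc j hj2 hj1
  have hM : ω₀.Mv = 16 := by unfold ΩG.Mv; rw [hF', hn']
  exact exists_wound_witness_shift (shiftBy_refShift_root w) (shiftBy_refShift_farW w) hr
    (fun γ r => γ.W2FreeOff r) (fun hm _ hf => YBWalk.W2FreeOff_of_mids_shift hm hf) ω₀ h₀
    (by rw [hF']; exact hnth) hfree (by rw [hM, hF']; exact hodd) θ

/-- Tight-frame witness block `SU1`: the 20 cells of an under w₁-free wound witness (reference root `(4, 2)`,
hole `(3, 2)`, far cell `(2, 2)`) AVOIDING `holeS (3,1)`; cells in `[1,5]×[−1,3]` (kit j295594 of the lane).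
[cite: GlazmanManolescu2019, §2.1 (finite domains of faces)] -/
def tightBlockSU142 : List Face := [(1,0),(1,1),(1,2),(2,-1),(2,0),(2,1),(2,2),(2,3),(3,-1),(3,0),(3,3),(4,-1),(4,0),(4,1),(4,2),(4,3),(5,-1),(5,0),(5,1),(5,2)]

/-- Its mid-edges (22 arcs). [cite: GlazmanManolescu2019, §1 (definition of the model), Fig. 1] -/
def tightSU1Mids : List MidEdge :=
  [.vert 4 2, .slant 4 2, .slant 4 1, .vert 4 0, .vert 3 0, .slant 2 1, .slant 2 2, .vert 2 2, .slant 1 2, .slant 1 1, .vert 2 0, .slant 2 0, .vert 3 (-1), .vert 4 (-1), .vert 5 (-1), .slant 5 0, .slant 5 1, .slant 5 2, .vert 5 2, .slant 4 3, .vert 4 3, .vert 3 3, .slant 2 3]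

/-- The witness as a walk of its block. [cite: GlazmanManolescu2019, §1 (definition of the model), Fig. 1] -/
def tightSU1Walk : YBWalk (dom tightBlockSU142) (w42.side .W) ((farW w42).side .N) where
  mids := tightSU1Mids
  head_eq := by decide
  getLast_eq := by decide
  nodup := by decide
  arc_mem := arc_mem_of_check (by decide)
  isChain := by decide
  noncross := noncross_of_check (by decide)

/-- The labelled witness. [cite: Glazman2015WeightedSAW, Lemma 3.1 (proof, pp. 6–7)] -/
def ωtightSU1 : ΩG (dom tightBlockSU142) (w42.side .W) (farW w42) := ⟨.N, tightSU1Walk⟩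

/-- Certificates: first hit `6`, `22` arcs, no later far-cell arc, first side `S`, w₁-free off the far cell, odd
eastern-ray count (`1`). [cite: Glazman2015WeightedSAW, Lemma 3.1 (proof, pp. 6–7)] [cite: CourantRobbins1958, Ch. V Appendix §2 (the even–odd rule)] -/
theorem ωtightSU1_cert : ωtightSU1.2.firstHitG = 6 ∧ ωtightSU1.2.arcs.length = 22 ∧
    (∀ j < 22, 6 < j → ωtightSU1.2.fc j ≠ farW w42) ∧ ωtightSU1.2.nth 6 = (farW w42).side .S ∧
    ωtightSU1.2.W1FreeOff (farW w42) ∧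
    Odd ((Finset.range 16).filter fun j => eastRayB w42 (ωtightSU1.2.nth (6 + j + 1)) = true).card := by
  refine ⟨by decide, by decide, by decide, by decide, by unfold YBWalk.W1FreeOff; decide, by decide⟩

/-- The block at the root plaquette `w`. [cite: GlazmanManolescu2019, §2.1, §4.2 (translation invariance)] -/
def tightBlockSU1 (w : Face) : List Face := tightBlockSU142.map (Face.shiftBy (refShift w))

/-- ★★★ The under w₁-free wound witness `SU1` at EVERY POSITION: any face list containing the translated block
carries a wound class-`B2a` under-walk at the far cell, w₁-free off it. [cite: GlazmanManolescu2019, §4.2 (translation invariance), Lemma 2.1]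
[cite: Glazman2015WeightedSAW, Lemma 3.1 (proof, pp. 6–7)] [cite: CourantRobbins1958, Ch. V Appendix §2 (the even–odd rule)] -/
theorem exists_under_W1FreeOff_of_tightBlockSU1 {Dl : List Face} {w : Face} (hB : ∀ c ∈ tightBlockSU1 w, c ∈ Dl)
    (hr : RootedFace (dom Dl) (w.side .W) (farW w)) (θ : ℝ) :
    ∃ (ω : ΩG (dom Dl) (w.side .W) (farW w)) (h : ω.IsB2a), ω.2.firstSideG = .S ∧
      ω.WE (fun _ => θ) ≠ excursionWinding θ ω.2.firstSideG (ω.z1 hr h) ω.1 ∧ ω.2.W1FreeOff (farW w) := by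
  have hB₀ := block42_mem_of_block_mem (B := tightBlockSU142) hB
  obtain ⟨hF, hn, hfc, hnth, hfree, hodd⟩ := ωtightSU1_cert
  let ω₀ : ΩG (dom (Dl.map (Face.shiftBy (-refShift w)))) (w42.side .W) (farW w42) :=
    ⟨.N, tightSU1Walk.mapDomain fun c hc => hB₀ c hc⟩
  have hF' : ω₀.2.firstHitG = 6 := hF
  have hn' : ω₀.2.arcs.length = 22 := hn
  have h₀ : ω₀.IsB2a := by
    refine ΩG.isB2a_of_forall_fc_ne (by rw [hF', hn']; omega) fun j hj1 hj2 => ?_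
    rw [hF'] at hj1
    rw [hn'] at hj2
    exact hfc j hj2 hj1
  have hM : ω₀.Mv = 16 := by unfold ΩG.Mv; rw [hF', hn']
  exact exists_wound_witness_shift (shiftBy_refShift_root w) (shiftBy_refShift_farW w) hr
    (fun γ r => γ.W1FreeOff r) (fun hm _ hf => YBWalk.W1FreeOff_of_mids_shift hm hf) ω₀ h₀
    (by rw [hF']; exact hnth) hfree (by rw [hM, hF']; exact hodd) θ

/-- Tight-frame witness block `NO1`: the 22 cells of an over w₁-free wound witness (reference root `(4, 2)`,
hole `(3, 2)`, far cell `(2, 2)`) AVOIDING `holeN (3,3)` — the row mirror of `tightBlockSU2`; cells in `[1,5]×[1,5]` (kit j295594 of the lane).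
[cite: GlazmanManolescu2019, §2.1 (finite domains of faces)] -/
def tightBlockNO142 : List Face := [(1,2),(1,3),(1,4),(1,5),(2,1),(2,2),(2,3),(2,4),(2,5),(3,1),(3,4),(3,5),(4,1),(4,2),(4,3),(4,4),(4,5),(5,1),(5,2),(5,3),(5,4),(5,5)]

/-- Its mid-edges (22 arcs). [cite: GlazmanManolescu2019, §1 (definition of the model), Fig. 1] -/
def tightNO1Mids : List MidEdge :=
  [.vert 4 2, .slant 4 3, .slant 4 4, .vert 4 4, .vert 3 4, .slant 2 4, .slant 2 3, .vert 2 2, .slant 1 3, .slant 1 4, .slant 1 5, .vert 2 5, .vert 3 5, .vert 4 5, .vert 5 5, .slant 5 5, .slant 5 4, .slant 5 3, .slant 5 2, .vert 5 1, .vert 4 1, .vert 3 1, .slant 2 2]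

/-- The witness as a walk of its block. [cite: GlazmanManolescu2019, §1 (definition of the model), Fig. 1] -/
def tightNO1Walk : YBWalk (dom tightBlockNO142) (w42.side .W) ((farW w42).side .S) where
  mids := tightNO1Mids
  head_eq := by decide
  getLast_eq := by decide
  nodup := by decide
  arc_mem := arc_mem_of_check (by decide)
  isChain := by decide
  noncross := noncross_of_check (by decide)

/-- The labelled witness. [cite: Glazman2015WeightedSAW, Lemma 3.1 (proof, pp. 6–7)] -/
def ωtightNO1 : ΩG (dom tightBlockNO142) (w42.side .W) (farW w42) := ⟨.S, tightNO1Walk⟩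

/-- Certificates: first hit `6`, `22` arcs, no later far-cell arc, first side `N`, w₁-free off the far cell, odd
eastern-ray count (`1`). [cite: Glazman2015WeightedSAW, Lemma 3.1 (proof, pp. 6–7)] [cite: CourantRobbins1958, Ch. V Appendix §2 (the even–odd rule)] -/
theorem ωtightNO1_cert : ωtightNO1.2.firstHitG = 6 ∧ ωtightNO1.2.arcs.length = 22 ∧
    (∀ j < 22, 6 < j → ωtightNO1.2.fc j ≠ farW w42) ∧ ωtightNO1.2.nth 6 = (farW w42).side .N ∧
    ωtightNO1.2.W1FreeOff (farW w42) ∧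
    Odd ((Finset.range 16).filter fun j => eastRayB w42 (ωtightNO1.2.nth (6 + j + 1)) = true).card := by
  refine ⟨by decide, by decide, by decide, by decide, by unfold YBWalk.W1FreeOff; decide, by decide⟩

/-- The block at the root plaquette `w`. [cite: GlazmanManolescu2019, §2.1, §4.2 (translation invariance)] -/
def tightBlockNO1 (w : Face) : List Face := tightBlockNO142.map (Face.shiftBy (refShift w))

/-- ★★★ The over w₁-free wound witness `NO1` at EVERY POSITION: any face list containing the translated block
carries a wound class-`B2a` over-walk at the far cell, w₁-free off it. [cite: GlazmanManolescu2019, §4.2 (translation invariance), Lemma 2.1]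
[cite: Glazman2015WeightedSAW, Lemma 3.1 (proof, pp. 6–7)] [cite: CourantRobbins1958, Ch. V Appendix §2 (the even–odd rule)] -/
theorem exists_over_W1FreeOff_of_tightBlockNO1 {Dl : List Face} {w : Face} (hB : ∀ c ∈ tightBlockNO1 w, c ∈ Dl)
    (hr : RootedFace (dom Dl) (w.side .W) (farW w)) (θ : ℝ) :
    ∃ (ω : ΩG (dom Dl) (w.side .W) (farW w)) (h : ω.IsB2a), ω.2.firstSideG = .N ∧
      ω.WE (fun _ => θ) ≠ excursionWinding θ ω.2.firstSideG (ω.z1 hr h) ω.1 ∧ ω.2.W1FreeOff (farW w) := by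
  have hB₀ := block42_mem_of_block_mem (B := tightBlockNO142) hB
  obtain ⟨hF, hn, hfc, hnth, hfree, hodd⟩ := ωtightNO1_cert
  let ω₀ : ΩG (dom (Dl.map (Face.shiftBy (-refShift w)))) (w42.side .W) (farW w42) :=
    ⟨.S, tightNO1Walk.mapDomain fun c hc => hB₀ c hc⟩
  have hF' : ω₀.2.firstHitG = 6 := hF
  have hn' : ω₀.2.arcs.length = 22 := hn
  have h₀ : ω₀.IsB2a := by
    refine ΩG.isB2a_of_forall_fc_ne (by rw [hF', hn']; omega) fun j hj1 hj2 => ?_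
    rw [hF'] at hj1
    rw [hn'] at hj2
    exact hfc j hj2 hj1
  have hM : ω₀.Mv = 16 := by unfold ΩG.Mv; rw [hF', hn']
  exact exists_wound_witness_shift (shiftBy_refShift_root w) (shiftBy_refShift_farW w) hr
    (fun γ r => γ.W1FreeOff r) (fun hm _ hf => YBWalk.W1FreeOff_of_mids_shift hm hf) ω₀ h₀
    (by rw [hF']; exact hnth) hfree (by rw [hM, hF']; exact hodd) θ

/-- Tight-frame witness block `NO2`: the 20 cells of an over w₂-free wound witness (reference root `(4, 2)`,
hole `(3, 2)`, far cell `(2, 2)`) AVOIDING `holeN (3,3)` — the row mirror of `tightBlockSU1`; cells in `[1,5]×[1,5]` (kit j295594 of the lane).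
[cite: GlazmanManolescu2019, §2.1 (finite domains of faces)] -/
def tightBlockNO242 : List Face := [(1,2),(1,3),(1,4),(2,1),(2,2),(2,3),(2,4),(2,5),(3,1),(3,4),(3,5),(4,1),(4,2),(4,3),(4,4),(4,5),(5,2),(5,3),(5,4),(5,5)]

/-- Its mid-edges (22 arcs). [cite: GlazmanManolescu2019, §1 (definition of the model), Fig. 1] -/
def tightNO2Mids : List MidEdge :=
  [.vert 4 2, .slant 4 3, .slant 4 4, .vert 4 4, .vert 3 4, .slant 2 4, .slant 2 3, .vert 2 2, .slant 1 3, .slant 1 4, .vert 2 4, .slant 2 5, .vert 3 5, .vert 4 5, .vert 5 5, .slant 5 5, .slant 5 4, .slant 5 3, .vert 5 2, .slant 4 2, .vert 4 1, .vert 3 1, .slant 2 2]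

/-- The witness as a walk of its block. [cite: GlazmanManolescu2019, §1 (definition of the model), Fig. 1] -/
def tightNO2Walk : YBWalk (dom tightBlockNO242) (w42.side .W) ((farW w42).side .S) where
  mids := tightNO2Mids
  head_eq := by decide
  getLast_eq := by decide
  nodup := by decide
  arc_mem := arc_mem_of_check (by decide)
  isChain := by decide
  noncross := noncross_of_check (by decide)

/-- The labelled witness. [cite: Glazman2015WeightedSAW, Lemma 3.1 (proof, pp. 6–7)] -/
def ωtightNO2 : ΩG (dom tightBlockNO242) (w42.side .W) (farW w42) := ⟨.S, tightNO2Walk⟩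

/-- Certificates: first hit `6`, `22` arcs, no later far-cell arc, first side `N`, w₂-free off the far cell, odd
eastern-ray count (`1`). [cite: Glazman2015WeightedSAW, Lemma 3.1 (proof, pp. 6–7)] [cite: CourantRobbins1958, Ch. V Appendix §2 (the even–odd rule)] -/
theorem ωtightNO2_cert : ωtightNO2.2.firstHitG = 6 ∧ ωtightNO2.2.arcs.length = 22 ∧
    (∀ j < 22, 6 < j → ωtightNO2.2.fc j ≠ farW w42) ∧ ωtightNO2.2.nth 6 = (farW w42).side .N ∧
    ωtightNO2.2.W2FreeOff (farW w42) ∧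
    Odd ((Finset.range 16).filter fun j => eastRayB w42 (ωtightNO2.2.nth (6 + j + 1)) = true).card := by
  refine ⟨by decide, by decide, by decide, by decide, by unfold YBWalk.W2FreeOff; decide, by decide⟩

/-- The block at the root plaquette `w`. [cite: GlazmanManolescu2019, §2.1, §4.2 (translation invariance)] -/
def tightBlockNO2 (w : Face) : List Face := tightBlockNO242.map (Face.shiftBy (refShift w))

/-- ★★★ The over w₂-free wound witness `NO2` at EVERY POSITION: any face list containing the translated block
carries a wound class-`B2a` over-walk at the far cell, w₂-free off it. [cite: GlazmanManolescu2019, §4.2 (translation invariance), Lemma 2.1]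
[cite: Glazman2015WeightedSAW, Lemma 3.1 (proof, pp. 6–7)] [cite: CourantRobbins1958, Ch. V Appendix §2 (the even–odd rule)] -/
theorem exists_over_W2FreeOff_of_tightBlockNO2 {Dl : List Face} {w : Face} (hB : ∀ c ∈ tightBlockNO2 w, c ∈ Dl)
    (hr : RootedFace (dom Dl) (w.side .W) (farW w)) (θ : ℝ) :
    ∃ (ω : ΩG (dom Dl) (w.side .W) (farW w)) (h : ω.IsB2a), ω.2.firstSideG = .N ∧
      ω.WE (fun _ => θ) ≠ excursionWinding θ ω.2.firstSideG (ω.z1 hr h) ω.1 ∧ ω.2.W2FreeOff (farW w) := by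
  have hB₀ := block42_mem_of_block_mem (B := tightBlockNO242) hB
  obtain ⟨hF, hn, hfc, hnth, hfree, hodd⟩ := ωtightNO2_cert
  let ω₀ : ΩG (dom (Dl.map (Face.shiftBy (-refShift w)))) (w42.side .W) (farW w42) :=
    ⟨.S, tightNO2Walk.mapDomain fun c hc => hB₀ c hc⟩
  have hF' : ω₀.2.firstHitG = 6 := hF
  have hn' : ω₀.2.arcs.length = 22 := hn
  have h₀ : ω₀.IsB2a := by
    refine ΩG.isB2a_of_forall_fc_ne (by rw [hF', hn']; omega) fun j hj1 hj2 => ?_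
    rw [hF'] at hj1
    rw [hn'] at hj2
    exact hfc j hj2 hj1
  have hM : ω₀.Mv = 16 := by unfold ΩG.Mv; rw [hF', hn']
  exact exists_wound_witness_shift (shiftBy_refShift_root w) (shiftBy_refShift_farW w) hr
    (fun γ r => γ.W2FreeOff r) (fun hm _ hf => YBWalk.W2FreeOff_of_mids_shift hm hf) ω₀ h₀
    (by rw [hF']; exact hnth) hfree (by rw [hM, hF']; exact hodd) θ

end Witnesses

end Literature.Barriers.CriticalPhenomena.PlaquetteWalk
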